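import Summits.CriticalPhenomena.SAWScalingLimit.Theorems.SAWRenewalTightnessTubeLowerBoundSteeredChainHelpers

/-!
# Crux `SAWRenewalTightness.TubeLowerBound` (stmt-CriticalPhenomena-4730), line `lieb-simon-star`:
normalisation of the open stub S1 (`CornerCrossingFloor`) — floors on width windows suffice

`stub_cornerCrossingFloor : CornerCrossingFloor` (the one open input of the line) asks for the corner-crossing
floor `c a^{-C}` at EVERY width `a ≥ 1`.  This file records the elementary reduction any future proof may use:
it is enough to produce, for all `a ≥ a₀`, SOME width `a' ∈ [a, a + g]` carrying the floor (bounded gaps), for one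
aspect `K`.  Mechanism: appending `j ≤ g` east steps to a corner-crossing walk of width `a'` gives one of width
`a' + j` inside the larger box (the gluing lemma `SteeredChain.glue_mass` with a straight tail), at the price `x_c^j`;
small widths are served by the straight walk.  Registered sub-goal `cornerCrossingFloor_of_windows`
(`--supports stmt-CriticalPhenomena-4730`); no definitions, the two local notations of the helper file are repeated
verbatim.
-/

noncomputable section

namespace Summit.CriticalPhenomena.SAWScalingLimit.Theorems.TubeLowerBound.LiebSimonStar

open scoped BigOperators Classical
open Literature.Probability.LatticeModels
open Literature.Probability.RandomPlanarGeometry Literature.Probability.RandomPlanarGeometry.SAW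

namespace SteeredChain

set_option quotPrecheck false in
/-- `boxAt(w, lo, hi, n)`: the `n`-step self-avoiding walks from `0` all of whose vertices `(x, y)` satisfy
`0 ≤ x ≤ w`, `lo ≤ y ≤ hi`, and whose last vertex lies on the east column `x = w` (verbatim from the helper file). -/
local notation "boxAt(" w ", " lo ", " hi ", " n ")" =>
  Finset.filter (fun ω : ℕ → Site 2 =>
    (∀ i ≤ n, 0 ≤ ω i 0 ∧ ω i 0 ≤ ((w : ℕ) : ℤ) ∧ lo ≤ ω i 1 ∧ ω i 1 ≤ hi) ∧ ω n 0 = ((w : ℕ) : ℤ))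
    (Zd.saws 2 n)

set_option quotPrecheck false in
/-- `bmass(w, lo, hi, N)`: the partial `x_c`-mass `Σ_{n ≤ N} Σ_{ω ∈ boxAt(w, lo, hi, n)} x_c^n` (verbatim). -/
local notation "bmass(" w ", " lo ", " hi ", " N ")" =>
  ∑ n ∈ Finset.range (N + 1), ∑ _ω ∈ boxAt(w, lo, hi, n), criticalFugacity ^ n

/-- The straight walk of length `w` is a corner-crossing walk of every box `[0, w] × [lo, hi]` with `lo ≤ 0 ≤ hi`. -/
theorem straightWalk_mem_boxAt (w : ℕ) {lo hi : ℤ} (hlo : lo ≤ 0) (hhi : 0 ≤ hi) :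
    Zd.straightWalk 2 w ∈ boxAt(w, lo, hi, w) := by
  refine Finset.mem_filter.2 ⟨Zd.straightWalk_mem_saws 2 w, fun i hi => ?_, by simp [Zd.straightWalk]⟩
  simp only [Zd.straightWalk, Fin.isValue, Pi.single_eq_same, ne_eq, one_ne_zero, not_false_eq_true,
    Pi.single_eq_of_ne, hlo, hhi, and_self, and_true, Nat.cast_nonneg, true_and]
  exact_mod_cast min_le_right i w

/-- The straight walk alone gives `x_c^w ≤ bmass(w, lo, hi, N)` for `w ≤ N`, `lo ≤ 0 ≤ hi`. -/
theorem pow_le_bmass {w N : ℕ} {lo hi : ℤ} (hw : w ≤ N) (hlo : lo ≤ 0) (hhi : 0 ≤ hi) :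
    criticalFugacity ^ w ≤ bmass(w, lo, hi, N) :=
  calc criticalFugacity ^ w ≤ ∑ _ω ∈ boxAt(w, lo, hi, w), criticalFugacity ^ w :=
      Finset.single_le_sum (f := fun _ => criticalFugacity ^ w)
        (fun _ _ => pow_nonneg criticalFugacity_pos.le w) (straightWalk_mem_boxAt w hlo hhi)
    _ ≤ bmass(w, lo, hi, N) :=
      Finset.single_le_sum (f := fun k => ∑ _ω ∈ boxAt(w, lo, hi, k), criticalFugacity ^ k)
        (fun k _ => Finset.sum_nonneg fun _ _ => pow_nonneg criticalFugacity_pos.le k)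
        (Finset.mem_range.2 (by omega))

/-- **Appending east steps**: `x_c^j · bmass(a', 0, K a', N) ≤ bmass(a' + j, 0, K (a' + j), N + j)` — a corner-crossing
walk of width `a'`, one east edge and a straight tail of length `j − 1` is a corner-crossing walk of width `a' + j`
(`glue_mass`; `j = 0` is monotonicity of the height window). -/
theorem bmass_append (K a' j N : ℕ) :
    criticalFugacity ^ j * bmass(a', 0, ((K * a' : ℕ) : ℤ), N) ≤
      bmass(a' + j, 0, ((K * (a' + j) : ℕ) : ℤ), N + j) := by
  have hx := criticalFugacity_pos_le_one
  have hKle : ((K * a' : ℕ) : ℤ) ≤ ((K * (a' + j) : ℕ) : ℤ) := by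
    exact_mod_cast Nat.mul_le_mul_left K (Nat.le_add_right a' j)
  rcases Nat.eq_zero_or_pos j with rfl | hj
  · simpa only [pow_zero, one_mul, add_zero] using bmass_mono a' (le_refl N) (le_refl (0 : ℤ)) hKle
  · -- glue a straight tail of length `j - 1`
    obtain ⟨i, rfl⟩ : ∃ i, j = i + 1 := ⟨j - 1, by omega⟩
    have key := glue_mass a' i N i (lo := 0) (hi := ((K * a' : ℕ) : ℤ)) (LO := 0)
      (HI := ((K * (a' + (i + 1)) : ℕ) : ℤ)) (le_refl _) hKle
    -- every tail window contains the straight walk: `x_c^i ≤ bmass(i, -e, HI - e, i)` for exit heights `0 ≤ e ≤ K a'`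
    have htail : ∀ m ∈ Finset.range (N + 1), ∀ ω ∈ boxAt(a', 0, ((K * a' : ℕ) : ℤ), m),
        criticalFugacity ^ m * criticalFugacity ^ i ≤
          criticalFugacity ^ m * bmass(i, 0 - ω m 1, ((K * (a' + (i + 1)) : ℕ) : ℤ) - ω m 1, i) := by
      intro m _ ω hω
      obtain ⟨-, hb, -⟩ := mem_boxAt.1 hω
      obtain ⟨-, -, h0, h1⟩ := hb m le_rfl
      refine mul_le_mul_of_nonneg_left (pow_le_bmass le_rfl (by linarith) ?_) (pow_nonneg hx.1.le m)
      linarith [hKle]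
    have hre : criticalFugacity ^ (i + 1) * bmass(a', 0, ((K * a' : ℕ) : ℤ), N) =
        criticalFugacity * ∑ m ∈ Finset.range (N + 1), ∑ ω ∈ boxAt(a', 0, ((K * a' : ℕ) : ℤ), m),
            criticalFugacity ^ m * criticalFugacity ^ i := by
      rw [pow_succ, mul_comm (criticalFugacity ^ i), mul_assoc, Finset.mul_sum]
      congr 1
      refine Finset.sum_congr rfl fun m _ => ?_
      rw [Finset.mul_sum]
      refine Finset.sum_congr rfl fun ω _ => ?_
      ring
    calc criticalFugacity ^ (i + 1) * bmass(a', 0, ((K * a' : ℕ) : ℤ), N)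
        = criticalFugacity * ∑ m ∈ Finset.range (N + 1), ∑ ω ∈ boxAt(a', 0, ((K * a' : ℕ) : ℤ), m),
            criticalFugacity ^ m * criticalFugacity ^ i := hre
      _ ≤ criticalFugacity * ∑ m ∈ Finset.range (N + 1), ∑ ω ∈ boxAt(a', 0, ((K * a' : ℕ) : ℤ), m),
            criticalFugacity ^ m * bmass(i, 0 - ω m 1, ((K * (a' + (i + 1)) : ℕ) : ℤ) - ω m 1, i) :=
          mul_le_mul_of_nonneg_left (Finset.sum_le_sum fun m hm => Finset.sum_le_sum fun ω hω =>
            htail m hm ω hω) hx.1.le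
      _ ≤ bmass(a' + 1 + i, 0, ((K * (a' + (i + 1)) : ℕ) : ℤ), N + 1 + i) := key
      _ = bmass(a' + (i + 1), 0, ((K * (a' + (i + 1)) : ℕ) : ℤ), N + (i + 1)) := by
          rw [show a' + 1 + i = a' + (i + 1) by ring, show N + 1 + i = N + (i + 1) by ring]

end SteeredChain

open SteeredChain

set_option quotPrecheck false in
/-- (notation repeated outside the sub-namespace for the statement of the registered sub-goal) -/
local notation "boxAt(" w ", " lo ", " hi ", " n ")" =>
  Finset.filter (fun ω : ℕ → Site 2 =>
    (∀ i ≤ n, 0 ≤ ω i 0 ∧ ω i 0 ≤ ((w : ℕ) : ℤ) ∧ lo ≤ ω i 1 ∧ ω i 1 ≤ hi) ∧ ω n 0 = ((w : ℕ) : ℤ))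
    (Zd.saws 2 n)

set_option quotPrecheck false in
/-- (notation repeated outside the sub-namespace for the statement of the registered sub-goal) -/
local notation "bmass(" w ", " lo ", " hi ", " N ")" =>
  ∑ n ∈ Finset.range (N + 1), ∑ _ω ∈ boxAt(w, lo, hi, n), criticalFugacity ^ n

/-- **Floors on width windows suffice for `CornerCrossingFloor`** (registered sub-goal, normalisation of S1).
If for one aspect `K`, constants `C ≥ 0`, `c > 0`, a gap `g` and a threshold `a₀`, every window `[a, a + g]`,
`a ≥ a₀`, contains a width `a'` whose corner-crossing partial mass is `≥ c · a'^{-C}`, then `CornerCrossingFloor`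
holds (with the same `K`, exponent `C` and constant `c' = min(c,1) · x_c^{a₀ + g + 1}`): widths below
`a₀ + g + 1` by the straight walk, larger widths `b` by appending `b − a' ≤ g` east steps to the good width
`a' ∈ [b − g, b]` (`bmass_append`). -/
theorem cornerCrossingFloor_of_windows : ∀ (K g a₀ : ℕ) (C c : ℝ), 0 ≤ C → 0 < c →
    (∀ a : ℕ, a₀ ≤ a → ∃ a' N : ℕ, a ≤ a' ∧ a' ≤ a + g ∧
      c * (a' : ℝ) ^ (-C) ≤ ∑ n ∈ Finset.range (N + 1), ∑ _ω ∈ (Zd.saws 2 n).filter (fun ω =>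
        (∀ i ≤ n, 0 ≤ ω i 0 ∧ ω i 0 ≤ (a' : ℤ) ∧ 0 ≤ ω i 1 ∧ ω i 1 ≤ (K : ℤ) * a') ∧ ω n 0 = (a' : ℤ)),
        criticalFugacity ^ n) →
    CornerCrossingFloor := by
  intro K g a₀ C c hC hc h
  have hx := criticalFugacity_pos_le_one
  set c₁ : ℝ := min c 1 with hc₁
  have hc₁pos : 0 < c₁ := lt_min hc one_pos
  have hc₁le : c₁ ≤ 1 := min_le_right _ _
  have hc₁c : c₁ ≤ c := min_le_left _ _
  refine ⟨K, C, c₁ * criticalFugacity ^ (a₀ + g + 1), hC, mul_pos hc₁pos (pow_pos hx.1 _), fun b hb => ?_⟩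
  -- the family of `CornerCrossingFloor` at width `w` is `boxAt(w, 0, K w, ·)` (same term)
  have fam : ∀ w N : ℕ, bmass(w, 0, ((K * w : ℕ) : ℤ), N) = ∑ n ∈ Finset.range (N + 1),
      ∑ _ω ∈ (Zd.saws 2 n).filter (fun ω =>
        (∀ i ≤ n, 0 ≤ ω i 0 ∧ ω i 0 ≤ (w : ℤ) ∧ 0 ≤ ω i 1 ∧ ω i 1 ≤ (K : ℤ) * w) ∧ ω n 0 = (w : ℤ)),
        criticalFugacity ^ n := by
    intro w N; push_cast; rfl
  have hbpos : (0 : ℝ) < b := by exact_mod_cast hb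
  have hbC : (b : ℝ) ^ (-C) ≤ 1 := Real.rpow_le_one_of_one_le_of_nonpos (by exact_mod_cast hb) (by linarith)
  by_cases hsmall : b < a₀ + g + 1
  · -- straight walk
    refine ⟨b, ?_⟩
    rw [← fam]
    have hX0 : 0 ≤ criticalFugacity ^ (a₀ + g + 1) := pow_nonneg hx.1.le _
    calc c₁ * criticalFugacity ^ (a₀ + g + 1) * (b : ℝ) ^ (-C)
        ≤ c₁ * criticalFugacity ^ (a₀ + g + 1) * 1 :=
          mul_le_mul_of_nonneg_left hbC (mul_nonneg hc₁pos.le hX0)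
      _ ≤ criticalFugacity ^ (a₀ + g + 1) := by rw [mul_one]; exact mul_le_of_le_one_left hX0 hc₁le
      _ ≤ criticalFugacity ^ b := pow_le_pow_of_le_one hx.1.le hx.2 hsmall.le
      _ ≤ bmass(b, 0, ((K * b : ℕ) : ℤ), b) := pow_le_bmass le_rfl le_rfl (by positivity)
  · replace hsmall : a₀ + g + 1 ≤ b := not_lt.1 hsmall
    obtain ⟨a', N, ha1, ha2, hfl⟩ := h (b - g) (by omega)
    obtain ⟨j, hj⟩ : ∃ j, b = a' + j := ⟨b - a', by omega⟩
    have hjg : j ≤ g := by omega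
    have ha'pos : (0 : ℝ) < a' := by exact_mod_cast (show 0 < a' by omega)
    refine ⟨N + j, ?_⟩
    rw [← fam, hj]
    have happ := bmass_append K a' j N
    rw [fam a' N] at happ
    calc c₁ * criticalFugacity ^ (a₀ + g + 1) * ((a' + j : ℕ) : ℝ) ^ (-C)
        ≤ c * criticalFugacity ^ j * (a' : ℝ) ^ (-C) := by
          have h1 : criticalFugacity ^ (a₀ + g + 1) ≤ criticalFugacity ^ j :=
            pow_le_pow_of_le_one hx.1.le hx.2 (by omega)
          have h2 : ((a' + j : ℕ) : ℝ) ^ (-C) ≤ (a' : ℝ) ^ (-C) :=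
            Real.rpow_le_rpow_of_nonpos ha'pos (by exact_mod_cast Nat.le_add_right a' j) (by linarith)
          have h3 : 0 ≤ ((a' + j : ℕ) : ℝ) ^ (-C) := Real.rpow_nonneg (by positivity) _
          exact mul_le_mul (mul_le_mul hc₁c h1 (pow_nonneg hx.1.le _) hc.le) h2 h3
            (mul_nonneg hc.le (pow_nonneg hx.1.le _))
      _ = criticalFugacity ^ j * (c * (a' : ℝ) ^ (-C)) := by ring
      _ ≤ criticalFugacity ^ j * ∑ n ∈ Finset.range (N + 1), ∑ _ω ∈ (Zd.saws 2 n).filter (fun ω =>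
            (∀ i ≤ n, 0 ≤ ω i 0 ∧ ω i 0 ≤ (a' : ℤ) ∧ 0 ≤ ω i 1 ∧ ω i 1 ≤ (K : ℤ) * a') ∧ ω n 0 = (a' : ℤ)),
            criticalFugacity ^ n := mul_le_mul_of_nonneg_left hfl (pow_nonneg hx.1.le _)
      _ ≤ bmass(a' + j, 0, ((K * (a' + j) : ℕ) : ℤ), N + j) := happ

end Summit.CriticalPhenomena.SAWScalingLimit.Theorems.TubeLowerBound.LiebSimonStar

end
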